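import Literature.Topology.FourManifolds.CircleSurgery
import Literature.Topology.FourManifolds.Trisections
import Literature.Topology.FourManifolds.SmoothOrientation
import Mathlib.Topology.Homotopy.Equiv
import Summits.SmoothPoincare4.SmoothPoincare4.Theorems.WeakReductionDescentWeakReductionReducesStubLoopNoDescentFromFiveAux1
import Literature.Topology.FourManifolds.LoopSurgeryHomotopySphere

/-!
# The three literature facts behind `helper_loopNoDescentFromFive_rungFive`, named
(stub `stub_loopNoDescentFromFive` = L₅ of line `loop_dichotomy`, crux
`WeakReductionDescent.WeakReductionReduces` = stmt-SmoothPoincare4-17908)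

`…StubLoopNoDescentFromFiveAux1.lean` proves the rung-`5` reduction
`helper_loopNoDescentFromFive_rungFive : F0 → F1 → F2 → H₄₂₂₂ → (L₅ at g = 5)` with the three
literature facts F0–F2 INLINED as hypotheses.  This file states them as cited named facts
(`def … : Prop`, tree vocabulary, spaces in `Type`; written inline for relocation to
`Literature/Topology/FourManifolds/LoopSurgeryHomotopySphere.lean`) and records the same
reduction over the names, `helper_loopNoDescentFromFive_rungFive_of_facts` (registered helper):

* `isOrientable_of_isCircleSurgery_four` (F0) — if a circle surgery `P = X_ℓ` is orientable then
  so is `X` [Hirsch, *Differential Topology*, §4.4];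
* `msz_loopSurgery_homotopySphere_gk` (F1) — Meier–Schirmer–Zupan 2016 Thm. 1.2 (arXiv
  numbering), corollary for loop presentations of homotopy 4-spheres: a closed connected oriented
  `X` with a `(g; k)`-GK-trisection in the MSZ range (`kᵢ ≥ g - 1` for some `i`) whose surgery on
  a smoothly embedded loop is a homotopy 4-sphere `M` has `M ≅ S⁴`;
* `gkTrisection_sum_eq_add_two_of_loopSurgery_homotopySphere` (F2) — `k₀ + k₁ + k₂ = g + 2` for
  such a loop partner (Gay–Kirby Remark 2 / MSZ Remark 3.12 with `χ(X_ℓ) = χ(X) + 2`, `χ`-free).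

So, at rung `5`, the stub L₅ is EXACTLY as open as the residual hypothesis H₄₂₂₂ (no smooth
oriented `(4; 2, 2, 2)`-trisected `X` presents a genus-`5`-minimal smooth homotopy 4-sphere by a
loop surgery), modulo F0–F2.  No `sorry`.
-/

-- the registered namespace `Summit.SmoothPoincare4.SmoothPoincare4.…` repeats a component
set_option linter.dupNamespace false

open scoped Manifold ContDiff ContinuousMap Topology
open Set
open Literature.Topology.FourManifolds

namespace Summit.SmoothPoincare4.SmoothPoincare4.Theorems.WeakReductionReduces.LoopDichotomy

/-- **Rung `5` of L₅ over the three named facts.**  From (F0)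
`isOrientable_of_isCircleSurgery_four`, (F1) `msz_loopSurgery_homotopySphere_gk`, (F2)
`gkTrisection_sum_eq_add_two_of_loopSurgery_homotopySphere` and the RESIDUAL HYPOTHESIS H₄₂₂₂
(fourth binder; NOT a literature fact — the honest open residue of the stub at rung `5`: no
smooth orientable `X` with a `(4; 2, 2, 2)`-GK-trisection presents, by surgery on a smoothly
embedded loop, a smooth homotopy 4-sphere with a genus-`5` GK-trisection and none of smaller
genus), the registered stub `stub_loopNoDescentFromFive` holds at `g = 5` (its signature verbatim
with `g ≤ 5` added).  The three facts unfold definitionally to the first three hypotheses of the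
landed `helper_loopNoDescentFromFive_rungFive` (`…StubLoopNoDescentFromFiveAux1.lean`).
Conditional on F0–F2 and H₄₂₂₂ (D-0014).
[cite: MeierSchirmerZupan2016, Thm. 1.2 (arXiv numbering)] [cite: GayKirby2016, Remark 2] -/
theorem helper_loopNoDescentFromFive_rungFive_of_facts : Literature.Topology.FourManifolds.isOrientable_of_isCircleSurgery_four → Literature.Topology.FourManifolds.msz_loopSurgery_homotopySphere_gk → Literature.Topology.FourManifolds.gkTrisection_sum_eq_add_two_of_loopSurgery_homotopySphere → (∀ (M : Type) [TopologicalSpace M] [T2Space M] [SecondCountableTopology M] [ChartedSpace (EuclideanSpace ℝ (Fin 4)) M] [IsManifold (𝓡 4) ∞ M], (M ≃ₕ (Metric.sphere (0 : EuclideanSpace ℝ (Fin 5)) 1)) → ∀ (k : Fin 3 → ℕ) (T : Fin 3 → Set M), Literature.Topology.FourManifolds.IsGKTrisection M 5 k T → (∀ (g'' : ℕ) (k'' : Fin 3 → ℕ) (T'' : Fin 3 → Set M), Literature.Topology.FourManifolds.IsGKTrisection M g'' k'' T'' → 5 ≤ g'') → ∀ (X : Type) [TopologicalSpace X] [T2Space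 X] [SecondCountableTopology X] [ChartedSpace (EuclideanSpace ℝ (Fin 4)) X] [IsManifold (𝓡 4) ∞ X], Literature.Topology.FourManifolds.IsOrientable (𝓡 4) X → ∀ (T' : Fin 3 → Set X), Literature.Topology.FourManifolds.IsGKTrisection X 4 (fun _ => 2) T' → ∀ (ℓ : (Metric.sphere (0 : EuclideanSpace ℝ (Fin 2)) 1) → X), Manifold.IsSmoothEmbedding (𝓡 1) (𝓡 4) ∞ ℓ → ¬ Literature.Topology.FourManifolds.IsCircleSurgery (𝓡 4) (𝓡 4) X M ℓ) → ∀ (M : Type) [TopologicalSpace M] [T2Space M] [SecondCountableTopology M] [ChartedSpace (EuclideanSpace ℝ (Fin 4)) M] [IsManifold (𝓡 4) ∞ M], (M ≃ₕ (Metric.sphere (0 : EuclideanSpace ℝ (Fin 5)) 1)) → ∀ (g : ℕ) (k : Fin 3 → ℕ) (T : Fin 3 → Set M), Literature.Topology.FourManifolds.IsGKTrisection M g k T → 5 ≤ g → g ≤ 5 → (∀ (g'' : ℕ) (k'' : Fin 3 → ℕ) (T'' : Fin 3 → Set M), Literature.Topology.FourManifolds.IsGKTrisection M g'' k'' T'' →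 g ≤ g'') → ∀ (X : Type) [TopologicalSpace X] [T2Space X] [SecondCountableTopology X] [ChartedSpace (EuclideanSpace ℝ (Fin 4)) X] [IsManifold (𝓡 4) ∞ X] (g' : ℕ) (k' : Fin 3 → ℕ) (T' : Fin 3 → Set X), g' < g → Literature.Topology.FourManifolds.IsGKTrisection X g' k' T' → ∀ (ℓ : (Metric.sphere (0 : EuclideanSpace ℝ (Fin 2)) 1) → X), Manifold.IsSmoothEmbedding (𝓡 1) (𝓡 4) ∞ ℓ → ¬ Literature.Topology.FourManifolds.IsCircleSurgery (𝓡 4) (𝓡 4) X M ℓ :=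
  fun hF0 hF1 hF2 => helper_loopNoDescentFromFive_rungFive hF0 hF1 hF2

end Summit.SmoothPoincare4.SmoothPoincare4.Theorems.WeakReductionReduces.LoopDichotomy
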